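/-
Copyright: the b2b-balaban cell (near-miss cell 7), T⁴-continuum fan-out; row NE7b ROUND-2 swarm, seat
t4-ne7b-formalise-leaf-03 (row S12 «ASSEMBLY» of `t4/b2b-balaban-t4-ne7b-p1/LEAVES-NE7b.md`; node A12 of the typer's
`t4/formal/NE7b/DAG.md`).  Released under the licence of the surrounding project.
-/
import Summits.QuantumFields.BalabanUV.T4Continuum.Support.HistoryAssemblyTrees
import Summits.QuantumFields.BalabanUV.T4Continuum.Support.HistoryZoneSurcharge

/-!
# History assembly with the ZONE-CROWDING multiplicity: the tree-slot exit after row S6e, everything kernel-able plugged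

Summits-side support leaf of the T⁴-continuum cell (rung (B)+1 on a FINITE torus only; NOT infinite volume, NOT the
mass gap, NOT the Clay statement; NOT a proof of the spine estimate NE7b).  Row NE7b, route «COUNT», ROUND-2 swarm
row S12 — the twin of `HistoryAssemblyTrees.hybridNE7_of_treeBinders_canon` over row S6e's exit
`HistoryZoneSurcharge.relWeightBound_lateMergersZ_of_irThreshold` (leaf-05), whose labelled-price binder admits the FULL
(GM) multiplicity `Kz^{#merges}·∏ Q(wcnt,σ,step)^p·Λ′^{partnerAges}` of row S6 (read on the flat genealogy
`gmap sh G′`), paid by lowering the birth constant against the named threshold `irThresholdZTH`.  [folklore] COMPOSITION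
BY NAME; nothing is quoted from print, nothing printed is asserted, no `[cite:]` tag, no `Prop`-valued fact of Bałaban's
is minted (trigger c1); (B), BetaPertH-flow, H3 DISPLAYED (c4).

WHAT.  §1 `treeRatesZ_of_large`: the surcharge exit's three rate binders at placement rate `Λ′e^{ε′}` with `Λ = Λ′ = L^d`,
`ε′ = η̄₊ = log 2`, from TWO largeness conditions on the free bank constants: `d·log L + 3·log 2 ≤ κ₁` and
`log (2 + birthMass C) ≤ E₀`.  §2 **`hybridNE7_of_treeBindersZ_canon`**: the surcharge exit at `Δ = 1` along the TUNED
runs with the typed flow (S8, clamped at the cutoff), cells `cellN d n F.L`, matching scale `jhalf`, the rates of §1 and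
both `Regeneration` runs (S11) PLUGGED, then the seam.  Displayed: constants (`ThresholdOK`, `0 < μ`, the two largeness
conditions, `n`, `Dcap`, `Ncap`), the zone constants `1 ≤ Kz`, `0 ≤ pz`, `0 < σ < 1`, `0 < θ` (free; row S6 fixes them),
flow side (⇐ BetaPertH), tuning, `irThresholdZTH sh C Kz pz σ (log 2) θ F.L rr β₀ ≤ log g⁻²`, the (2.5) side condition,
the (B) side, H3's numerator readings, the FOUR TREE-SLOT (ID) BINDERS in the zone form — at every counted slot either
`y ≤ 0` or a `ConsistentT`, fresh, SHAPE-GENERIC (`Set.InjOn sh ↑G′.events` — row S6e's display while the crowding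
lemmas run on the flat genealogy), pending tagged genealogy `G′` of the slot's shape with `y ≤ Kz^{#merges (gmap sh
G′)}·∏Q^pz·(L^d)^{partnerAges (gmap sh G′)}·e^{−credits∘sh}·e^{+lifeCost costT}` — and the seam data.  They are
ASSUMED here (referee OI-2 discipline): suppliers = the socket ∕ the term-keyed builder once rows S6∕S6e∕S10 price with
the zone multiplicity.

HEADLINE (c4): «COUNT route, tree-slot form WITH the (GM) multiplicity: exit + seam with every kernel-able binder
plugged; H3 + (ID) zone-form binders + (B) + BetaPertH-flow + NE7c socket + NE7 core budget displayed» — NOT «NE7b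
proved».  HONEST DEPENDENCY (cell): continuum YM on T⁴ ⇐ BetaPertH ∧ nine spine estimates (0/9 proved); BetaPertH ⇐
(D1) ∧ (D4) ∧ CAP+tail.  This file changes none of it.
-/

open Finset MeasureTheory
open Literature.MathematicalPhysics.QuantumFieldTheory.Balaban1983to89
open T4PersistenceDictionary T4PersistentHistoryCount T4BankedInduction T4PrintedShapeBanking
open T4WeightBudget T4GlobalDenominator T4LiveClassFibration T4LiveStructureGas T4LiveGasToTerms T4RecordPriceSeam
open T4PartnerMultiplicity T4IndicatorShell T4MatchingAssembly T4MatchingClosure T4MatchingClosureSocket T4Continuum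
open T4StabilitySocket T4BranchingRecordsGas T4TaggedShapeBanking T4CanonicalMenus T4RenewalChains
open Summit.QuantumFields.BalabanUV.T4Continuum.PlacementBatch
open Summit.QuantumFields.BalabanUV.T4Continuum.PlacementSkeleton
open Summit.QuantumFields.BalabanUV.T4Continuum.Crowding
open Summit.QuantumFields.BalabanUV.T4Continuum.CountThresholdUniform
open Summit.QuantumFields.BalabanUV.T4Continuum.CountThresholdExit
open Summit.QuantumFields.BalabanUV.T4Continuum.CountSeamJunction
open Summit.QuantumFields.BalabanUV.T4Continuum.LateMergers
open Summit.QuantumFields.BalabanUV.T4Continuum.HistoryFlow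
open Summit.QuantumFields.BalabanUV.T4Continuum.HistoryRegeneration
open Summit.QuantumFields.BalabanUV.T4Continuum.HistoryTables
open Summit.QuantumFields.BalabanUV.T4Continuum.HistoryAssemblyTrees
open Summit.QuantumFields.BalabanUV.T4Continuum.HistoryZoneSurcharge
open Summit.QuantumFields.BalabanUV.T4Continuum.ZoneSkeleton

namespace Summit.QuantumFields.BalabanUV.T4Continuum.HistoryAssemblyZone

noncomputable section

/-! ## §1 The surcharge exit's three rates at placement rate `2·L^d`, `η̄₊ = log 2` -/

section Rates

/-- **THE ZONE-COUNT RATES FROM LARGE `κ₁` AND `E₀`.**  With `Λ = Λ′ = L^d`, placement rate `Λ′e^{log 2}`, `η̄₊ = log 2`,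
birth mass `bm ≥ 0`: if `d·log L + 3·log 2 ≤ κ₁` (so `2·L^d·e^{−κ₁} ≤ ¼`) and `log (2 + bm) ≤ E₀`, then the root rate,
the partner rate and the fixed point of `HistoryZoneSurcharge.relWeightBound_lateMergersZ_of_irThreshold` hold. [folklore] -/
theorem treeRatesZ_of_large {L : ℕ} (hL : 1 ≤ L) (d : ℕ) {κ₁ E₀ bm : ℝ} (hbm : 0 ≤ bm)
    (hκ : (d : ℝ) * Real.log L + 3 * Real.log 2 ≤ κ₁) (hE : Real.log (2 + bm) ≤ E₀) :
    (L : ℝ) ^ d * Real.exp (Real.log 2 - κ₁) < 1 ∧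
      (L : ℝ) ^ d * Real.exp (Real.log 2) * Real.exp (-κ₁) * Real.exp (Real.log 2) < 1 ∧
      (Real.exp (-E₀) + Real.exp (-E₀) * bm *
          ((L : ℝ) ^ d * Real.exp (Real.log 2) * Real.exp (-κ₁) /
            (1 - (L : ℝ) ^ d * Real.exp (Real.log 2) * Real.exp (-κ₁) * Real.exp (Real.log 2)))) *
        Real.exp (Real.log 2) ≤ Real.exp (Real.log 2) - 1 := by
  have h2 : Real.exp (Real.log 2) = 2 := Real.exp_log two_pos
  rw [h2]
  -- `q = 2·L^d·e^{−κ₁} ≤ ¼`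
  set q : ℝ := (L : ℝ) ^ d * 2 * Real.exp (-κ₁) with hq
  have hq0 : 0 ≤ q := by positivity
  have hq4 : q ≤ 1 / 4 := by
    have hq' : q = Real.exp ((d : ℝ) * Real.log L + Real.log 2 - κ₁) := by
      rw [hq, pow_eq_exp_mul_log hL d, sub_eq_add_neg, Real.exp_add, Real.exp_add, h2]
    rw [hq']
    have hle : (d : ℝ) * Real.log L + Real.log 2 - κ₁ ≤ -(2 * Real.log 2) := by linarith
    calc Real.exp ((d : ℝ) * Real.log L + Real.log 2 - κ₁) ≤ Real.exp (-(2 * Real.log 2)) := Real.exp_le_exp.2 hle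
      _ = 1 / 4 := by
          rw [show -(2 * Real.log 2) = Real.log ((2 : ℝ) ^ 2)⁻¹ by
            rw [Real.log_inv, Real.log_pow]; push_cast; ring]
          rw [Real.exp_log (by positivity)]; norm_num
  have hroot : (L : ℝ) ^ d * Real.exp (Real.log 2 - κ₁) = q := by
    rw [hq, Real.exp_sub, h2, Real.exp_neg]; ring
  refine ⟨by rw [hroot]; linarith, by linarith, ?_⟩
  -- the fixed point: `2e^{−E₀}(1 + bm·q∕(1−2q)) ≤ 1`
  have hfrac : q / (1 - q * 2) ≤ 1 / 2 := by
    rw [div_le_iff₀ (by linarith)]; linarith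
  have hE' : Real.exp (-E₀) * (2 + bm) ≤ 1 := by
    have h1 : 2 + bm ≤ Real.exp E₀ := by
      calc 2 + bm = Real.exp (Real.log (2 + bm)) := (Real.exp_log (by linarith)).symm
        _ ≤ Real.exp E₀ := Real.exp_le_exp.2 hE
    rw [Real.exp_neg]
    calc (Real.exp E₀)⁻¹ * (2 + bm) ≤ (Real.exp E₀)⁻¹ * Real.exp E₀ :=
          mul_le_mul_of_nonneg_left h1 (inv_nonneg.2 (Real.exp_pos _).le)
      _ = 1 := inv_mul_cancel₀ (Real.exp_pos _).ne'
  have he0 : 0 ≤ Real.exp (-E₀) := (Real.exp_pos _).le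
  have hmid : Real.exp (-E₀) * bm * (q / (1 - q * 2)) ≤ Real.exp (-E₀) * bm * (1 / 2) :=
    mul_le_mul_of_nonneg_left hfrac (mul_nonneg he0 hbm)
  nlinarith [hmid, hE', he0, hbm]

end Rates

/-! ## §2 The surcharge exit along the tuned runs, everything kernel-able plugged -/

section ExitLevel

variable {F : T4Family} {G : Type*} [GaugeGroup G] [MeasurableSpace G] [HaarData G] [RegularGaugeGroup G]
variable {ε : Type*} [DecidableEq ε]
variable {ι κc : Type*} [DecidableEq κc] [DecidableEq ι] {l₀ vol : ℝ} {K₀ : ℕ} {π : ℕ → ι → κc}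
  {T : ℕ → Finset ι} {A A' shA shB : ℕ → ℝ → ι → ℝ} {Bad' : ℕ → ℝ → Finset κc} {dead dead' : ℕ → ℝ → ι → ℝ}
  {Fc Rf Fc' Rf' : ℕ → κc → ℝ} {nup mup : ℕ → ℝ → ℝ} {Nup : ℝ}
  {Cc Rr CcRec RrRec : ℕ → ℝ → ι → ℝ} {ν u s₂ q₀ r s Wsh : ℕ → ℝ}

/-- **NE7b's COUNT EXIT WITH THE (GM) MULTIPLICITY, ALL KERNEL-ABLE BINDERS PLUGGED.**
`HistoryZoneSurcharge.relWeightBound_lateMergersZ_of_irThreshold` at `Δ = 1`, `ε′ = log 2`, `Λ = Λ′ = L^d`, along the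
TUNED runs `D.C ⟨K, F.m, g₀ K⟩`, with the typed flow (`HistoryFlow.flowBinders_of_tuned`, clamped at the cutoff for the
profile binder), cells `cellN d n F.L`, matching scale `jhalf`, the rates (`treeRatesZ_of_large`) and both `Regeneration`
runs (`HistoryRegeneration.regeneration_pair_of_cor3With`) plugged, then `CountSeamJunction.hybridNE7_of_eventually`.
Displayed: constants + two largeness conditions, zone constants, flow, tuning, `irThresholdZTH … ≤ log g⁻²`, (2.5) side
condition, (B) side, H3 numerator readings, the four tree-slot (ID) binders in the ZONE form, the seam data.  Weight:
`constOf … · recordsBudget (birthMass C) κ₁ n^d L^d (log 2) jhalf`. [folklore] -/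
theorem hybridNE7_of_treeBindersZ_canon (D : FiniteEpsData F G) (sh : ε → PEv) {C : T4PrintedShapeBanking.Consts}
    {rr : ℕ} {β₀ : ℝ} (h : ThresholdOK C F.L rr β₀) (hμ : 0 < C.μ) (d n : ℕ) (Dcap Ncap : ℕ → ℕ)
    -- two largeness conditions on the free bank constants
    (hκ₁ : (d : ℝ) * Real.log F.L + 3 * Real.log 2 ≤ C.κ₁) (hE₀ : Real.log (2 + birthMass C) ≤ C.E₀)
    -- the zone constants (free; row S6 fixes `Kz = 2^d(C₀+2∕(1−σ²)+1)^d`, `pz = d`, `σ² = 1∕L`)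
    {Kz pz σ θ : ℝ} (hKz : 1 ≤ Kz) (hpz : 0 ≤ pz) (h0 : 0 < σ) (h1σ : σ < 1) (hθ : 0 < θ)
    -- the flow side (⇐ BetaPertH, displayed) and tuning
    {γ₀ γb b β' : ℝ} {pe : ℕ} (hb : 0 ≤ b) (hlo : FlowStep.BetaLowerH b γ₀ D.βfun)
    (hhi : FlowStep.BetaUpperH β' γ₀ D.βfun) (hγ : γb ≤ γ₀) (hγβ : γb ^ 2 * β' < 1)
    (S : B14FlowStep.SmallnessFor γb β' β₀ F.L pe) (hp₀ : C.p₀ ≤ pe) (hrr : rr ≤ pe)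
    {g : ℝ} {g₀ : ℕ → ℝ} (ht : D.Tuned γb g g₀)
    (hir : irThresholdZTH sh C Kz pz σ (Real.log 2) θ F.L rr β₀ ≤ Real.log (g ^ 2)⁻¹)
    -- the (B) side
    (hsign : B16.SignConventions D.C) {γB : ℝ} {em ep : ℝ → ℝ} (hcor : B16.Cor3With D.C γB em ep) (hγB : γb ≤ γB)
    {obs : (K : ℕ) → GaugeField (F.P K) 0 G → ℝ} {B : ℝ}
    (hobs : ∀ K, Measurable (obs K)) (hbd : ∀ K U, |obs K U| ≤ B)
    (hα : ∀ K t, |t| ≤ l₀ → K₀ ≤ K →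
      ∫ U, Real.exp (t * obs K U) * D.dens K (g₀ K) 0 U ∂fieldMeasure (F.P K) 0 G ≤ ∑ τ ∈ T K, A K t τ)
    (hα' : ∀ K t, |t| ≤ l₀ → K₀ ≤ K →
      ∫ U, Real.exp (t * obs (K + 1) U) * D.dens (K + 1) (g₀ (K + 1)) 0 U ∂fieldMeasure (F.P (K + 1)) 0 G ≤
        ∑ τ ∈ T K, A' K t τ)
    {c₀ n₁ : ℝ} (hc₀ : 0 < c₀) (hfloor : ∀ K, K₀ ≤ K → c₀ ≤ smallFieldMass D K (g₀ K))
    (hfloor' : ∀ K, K₀ ≤ K → c₀ ≤ smallFieldMass D (K + 1) (g₀ (K + 1)))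
    (hsites : ∀ K, K₀ ≤ K → ((D.C ⟨K, F.m, g₀ K⟩).numSites K : ℝ) ≤ n₁)
    (hsites' : ∀ K, K₀ ≤ K → ((D.C ⟨K + 1, F.m, g₀ (K + 1)⟩).numSites (K + 1) : ℝ) ≤ n₁)
    (hNup : 0 ≤ Nup) (hnup : ∀ K t, |t| ≤ l₀ → K₀ ≤ K → 0 ≤ nup K t ∧ nup K t ≤ Nup)
    (hmup : ∀ K t, |t| ≤ l₀ → K₀ ≤ K → 0 ≤ mup K t ∧ mup K t ≤ Nup)
    -- H3: the displayed numerator reading of both runs over the ABSTRACT term family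
    (bad_subset : ∀ K t, |t| ≤ l₀ → K₀ ≤ K → Bad' K t ⊆ classIndex π T K)
    (up : ∀ K t, |t| ≤ l₀ → K₀ ≤ K → ∀ c ∈ Bad' K t, ∀ τ ∈ fibre π T K c, A K t τ ≤ dead K t τ * Fc K c * nup K t)
    (dead_nonneg : ∀ K t, |t| ≤ l₀ → K₀ ≤ K → ∀ c ∈ Bad' K t, ∀ τ ∈ fibre π T K c, 0 ≤ dead K t τ)
    (resum : ∀ K t, |t| ≤ l₀ → K₀ ≤ K → ∀ c ∈ Bad' K t, ∑ τ ∈ fibre π T K c, dead K t τ ≤ Rf K c)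
    (F_nonneg : ∀ K t, |t| ≤ l₀ → K₀ ≤ K → ∀ c ∈ Bad' K t, 0 ≤ Fc K c)
    (up' : ∀ K t, |t| ≤ l₀ → K₀ ≤ K → ∀ c ∈ Bad' K t, ∀ τ ∈ fibre π T K c,
      A' K t τ ≤ dead' K t τ * Fc' K c * mup K t)
    (dead'_nonneg : ∀ K t, |t| ≤ l₀ → K₀ ≤ K → ∀ c ∈ Bad' K t, ∀ τ ∈ fibre π T K c, 0 ≤ dead' K t τ)
    (resum' : ∀ K t, |t| ≤ l₀ → K₀ ≤ K → ∀ c ∈ Bad' K t, ∑ τ ∈ fibre π T K c, dead' K t τ ≤ Rf' K c)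
    (F'_nonneg : ∀ K t, |t| ≤ l₀ → K₀ ≤ K → ∀ c ∈ Bad' K t, 0 ≤ Fc' K c)
    -- the (2.5) side condition on the size function the (ID) data are built over
    (R : ℕ → ℕ → ℕ) (hR : ∀ K s, s ≤ K → B14.IsRj F.L rr ((D.C ⟨K, F.m, g₀ K⟩).flow.g s) (R K s))
    -- the four TREE-SLOT (ID) binders, ZONE form (price with the (GM) multiplicity on the flat genealogy)
    (y : ℕ → ℕ → (Fin d → ℕ) → Gen PEv → ℝ)
    (hy0 : ∀ K, ∀ j ≤ K, ∀ z ∈ cellN d n F.L K (K - j), ∀ Gs ∈ canonFam Dcap Ncap K j, 0 ≤ y K j z Gs)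
    (hlabZT : ∀ K, K₀ ≤ K → ∀ j ≤ K, ∀ z ∈ cellN d n F.L K (K - j), ∀ Gs ∈ canonFam Dcap Ncap K j,
      y K j z Gs ≤ 0 ∨ ∃ G' : Gen ε, ConsistentT sh C K (R K) G' ∧ FreshT G' ∧
        Set.InjOn sh (G'.events : Set ε) ∧ K < G'.reach (dictWT sh (R K) C.n₁) ∧ relabel (shape ∘ sh) G' = Gs ∧
        y K j z Gs ≤ Kz ^ (merges (gmap sh G')).card *
          (∏ e ∈ merges (gmap sh G'), Crowding.Q (wcnt (gmap sh G')) σ e.step ^ pz) *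
          ((F.L : ℝ) ^ d) ^ partnerAges PEv.step (gmap sh G') *
            (Real.exp (-credits (credit C (D.C ⟨K, F.m, g₀ K⟩).flow.g ∘ sh) G') *
              Real.exp (lifeCost (dictWT sh (R K) C.n₁) (costT sh C K (R K)) G')))
    (str : ℕ → κc → Finset (BSlot (Fin d → ℕ) PEv))
    (hinj : ∀ K t, |t| ≤ l₀ → K₀ ≤ K → Set.InjOn (str K) (Bad' K t))
    (hstr : ∀ K t, |t| ≤ l₀ → K₀ ≤ K → ∀ cl ∈ Bad' K t,
      str K cl ⊆ bliveSlots (cellN d n F.L) (canonFam Dcap Ncap) K ∧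
        ∃ o ∈ boldSlots (cellN d n F.L) (canonFam Dcap Ncap) jhalf K, o ∈ str K cl)
    (hF : ∀ K t, |t| ≤ l₀ → K₀ ≤ K → ∀ cl ∈ Bad' K t, Fc K cl * Rf K cl ≤ famWeight (bslotPrice (y K)) (str K cl))
    (hF' : ∀ K t, |t| ≤ l₀ → K₀ ≤ K → ∀ cl ∈ Bad' K t,
      Fc' K cl * Rf' K cl ≤ famWeight (bslotPrice (y K)) (str K cl))
    -- the seam's other inputs
    (hSh : ShellWeightBound l₀ T A A' shA shB Wsh)
    (hTB : ReindexedBudget l₀ vol T (fun K t τ => A K t τ - shA K t τ) (fun K t τ => A' K t τ - shB K t τ)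
      (badOfClass π T Bad') Cc Rr CcRec RrRec ν u s₂ q₀ r s)
    (hr : Summable r) (hu : Summable u) (hs : Summable s) (hs₂ : Summable s₂) :
    ∃ K₁ K₂, K₀ ≤ K₁ ∧ HybridNE7 l₀ vol (fun K => T (K₁ + (K₂ + K))) (fun K => A (K₁ + (K₂ + K)))
      (fun K => A' (K₁ + (K₂ + K))) (fun K => badOfClass π T Bad' (K₁ + (K₂ + K)))
      (fun K => constOf l₀ B (max (em g) 0) n₁ c₀ Nup *
        recordsBudget (birthMass C) C.κ₁ ((n : ℝ) ^ d) ((F.L : ℝ) ^ d) (Real.log 2) jhalf (K₁ + (K₂ + K)))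
      (fun K => shA (K₁ + (K₂ + K))) (fun K => shB (K₁ + (K₂ + K))) (fun K => Wsh (K₁ + (K₂ + K)))
      (fun K => (r (K₁ + (K₂ + K)) + u (K₁ + (K₂ + K))) + (s (K₁ + (K₂ + K)) + s₂ (K₁ + (K₂ + K)))) := by
  -- (i) the typed flow along the tuned runs (S8), clamped at the cutoff
  obtain ⟨h27, h29, hx1, -⟩ := flowBinders_of_tuned D hb hlo hhi hγ hγβ S hp₀ hrr ht R hR
  set gr : ℕ → ℕ → ℝ := fun K s => (D.C ⟨K, F.m, g₀ K⟩).flow.g (min s K) with hgr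
  have h27' : ∀ K, K₀ ≤ K → B14.FlowIneq27 (gr K) β' β₀ C.p₀ K := fun K _ => flowIneq27_clamp (h27 K)
  have h29' : ∀ K, K₀ ≤ K → B14FlowStep.FlowIneq29 (R K) (gr K) F.L β' β₀ K := fun K _ => flowIneq29_clamp (h29 K)
  have hR' : ∀ K, K₀ ≤ K → ∀ s, s ≤ K → B14.IsRj F.L rr (gr K s) (R K s) := by
    intro K _ s hs
    show B14.IsRj F.L rr ((D.C ⟨K, F.m, g₀ K⟩).flow.g (min s K)) (R K s)
    rw [min_eq_left hs]; exact hR K s hs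
  have hx1' : ∀ K, K₀ ≤ K → ∀ s, s ≤ K → 1 ≤ Real.log ((gr K s) ^ 2)⁻¹ := by
    intro K _ s hs
    show 1 ≤ Real.log (((D.C ⟨K, F.m, g₀ K⟩).flow.g (min s K)) ^ 2)⁻¹
    rw [min_eq_left hs]; exact hx1 K s hs
  have hir' : ∀ K, K₀ ≤ K → irThresholdZTH sh C Kz pz σ (Real.log 2) θ F.L rr β₀ ≤ Real.log ((gr K K) ^ 2)⁻¹ := by
    intro K _
    show _ ≤ Real.log (((D.C ⟨K, F.m, g₀ K⟩).flow.g (min K K)) ^ 2)⁻¹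
    rw [min_self, (ht K).2]; exact hir
  have hP : ∀ K s, 0 ≤ p0Profile C.A₀ C.p₀ (gr K s) := fun K s =>
    p0Profile_nonneg_of_one_le_log C.p₀ h.A₀_pos.le (hx1 K (min s K) (min_le_right s K))
  -- (iii) the two `Regeneration` runs with ONE constant (S11)
  obtain ⟨hA, hA'⟩ := regeneration_pair_of_cor3With D hsign hcor hγB ht hobs hbd hα hα' hc₀ hfloor hfloor' hsites
    hsites' hnup hmup bad_subset up dead_nonneg resum F_nonneg up' dead'_nonneg resum' F'_nonneg
  have hCn : 0 ≤ constOf l₀ B (max (em g) 0) n₁ c₀ Nup := constOf_nonneg hNup hc₀.le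
  -- (ii) cells, matching scale, rates
  have hL1 : 1 ≤ F.L := le_trans (by norm_num) (two_le_L F)
  have hLpos : (0 : ℝ) < F.L := by exact_mod_cast (lt_of_lt_of_le (by norm_num) hL1)
  obtain ⟨hrate, h1, hx⟩ := treeRatesZ_of_large hL1 d (birthMass_nonneg hμ) hκ₁ hE₀
  -- the labelled-price binder in the exit's `Δ = 1` form, over the clamped run
  have hlab' : ∀ K, K₀ ≤ K → ∀ j ≤ K, ∀ z ∈ cellN d n F.L K (K - j), ∀ Gs ∈ canonFam Dcap Ncap K j,
      y K j z Gs ≤ 0 ∨ ∃ G' : Gen ε, ConsistentT sh C K (R K) G' ∧ FreshT G' ∧ Set.InjOn sh (G'.events : Set ε) ∧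
        K < G'.reach (dictWT sh (R K) C.n₁) ∧ relabel (shape ∘ sh) G' = Gs ∧
        y K j z Gs ≤ 1 * (Kz ^ (merges (gmap sh G')).card *
          (∏ e ∈ merges (gmap sh G'), Crowding.Q (wcnt (gmap sh G')) σ e.step ^ pz) *
          ((F.L : ℝ) ^ d) ^ partnerAges PEv.step (gmap sh G') * (Real.exp (-credits (credit C (gr K) ∘ sh) G') *
            Real.exp (lifeCost (padW (dictWT sh (R K) C.n₁) 0) (costT sh C K (R K)) G'))) := by
    intro K hK j hj z hz Gs hGs
    rcases hlabZT K hK j hj z hz Gs hGs with h0 | ⟨G', hc, hf, hinjG, hreach, hrel, hy⟩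
    · exact Or.inl h0
    · refine Or.inr ⟨G', hc, hf, hinjG, hreach, hrel, ?_⟩
      rw [one_mul, padW_zero, credits_clamp sh C _ hc]
      exact hy
  have hmain := relWeightBound_lateMergersZ_of_irThreshold sh h hμ hKz hpz h0 h1σ (Real.log_pos one_lt_two) hθ
    (cellN d n F.L) (V := (n : ℝ) ^ d) (Λ := (F.L : ℝ) ^ d) (by positivity) (pow_pos hLpos d)
    (card_cellN_le d n hL1) Dcap Ncap jhalf jhalf_le (c := 1 / 2) (by norm_num) half_le_sub_jhalf (Δ := 1) le_rfl hA
    hA' hCn R gr (fun _ => β') h27' h29' hR' hx1' hir' hP (Real.log_nonneg one_le_two) hrate (pow_nonneg hLpos.le d) h1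
    hx y hy0 hlab' str hinj hstr hF hF'
  have e0 : (1 : ℝ) * Real.exp (C.κ₁ * ((0 : ℕ) : ℝ)) * birthMass C = birthMass C := by simp
  rw [e0] at hmain
  exact hybridNE7_of_eventually hmain hSh hTB hr hu hs hs₂

end ExitLevel

end

end Summit.QuantumFields.BalabanUV.T4Continuum.HistoryAssemblyZone
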